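import Literature.NumberTheory.LFunctions.KMVPrimeAveragedDiagOnly

/-!
# Route `PrimeLevelFamEdge` — TYPED IDEA DELTAS, deck 33 (LANDING NOTE typer ls-idea-typ-1 gen 4: lens-20 g12's
# `HOME/ls-idea-lens-20/g12/Sketch_L20v_GoodPrimesGuardThin.lean` sha16 de902aa636493761 VERBATIM up to namespace
# `Summit.Parity.GeneralizedHardyLittlewood.Theses.PrimeLevelFamEdge.LensTwentySketchV` → `…Theorems.PrimeLevelFamEdgeIdeaDeltas.GoodPrimesGuardThin`; crux idea `l20-l6-principal-sqrt-barrier` rev 3.5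
# (P-E25-3: the heart's `goodPrimes` guard is thin); D b132 PASS / E b25.1 «optional deck, no objection»; 8 one-line docstrings added (lint).)
#
# Lens-20 (negation) g12 — E b25 precision P-E25-3 answered on the tree text:
# the heart's `goodPrimes` guard excises a THIN, explicitly parametrised level set

E (ref-5) b25 on `l20-l6-principal-sqrt-barrier` rev 3.4, precision P-E25-3: «[H-struct]: check the heart's
`goodPrimes` filter is a finite union of congruence/divisibility classes in `q` before typing».

CHECK (tree text). The `_io` heart `stub_offDiagBelowSlack_io` (`Cruxes/BeyondDiagonalBeatsQuarter/Lines/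
diagonal_kernel_split.lean` :140–149) selects levels by `q.Prime ∧ ∀ n : ℕ, (n : ℝ) ≠ KMV2000.qhat q ^ Δ'`, and
`KMV2000.goodPrimes Δ' N` (`Literature/NumberTheory/LFunctions/KMVPrimeAveragedDiagOnly.lean` :100) is
`(Icc (N+1) (2N)).filter (q.Prime ∧ ∀ n, (n : ℝ) ≠ (√q/(2π))^Δ')` — KMV's proviso `M = q̂^{Δ'} ∉ ℤ` and nothing else.
So the filter is NOT a finite union of congruence / divisibility classes; it is «prime» MINUS the set
`badLevels Δ' N` of primes `q ∈ (N, 2N]` with `q̂(q)^{Δ'} ∈ ℕ`.  This file proves that the excised set is THIN and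
EXPLICIT:

* `mem_badLevels_explicit` — every excised level is `q = (2π)² · n^{2/Δ'}` for a natural number `n ≥ 1`
  (one transcendental curve, no arithmetic progression);
* `qh_rpow_strictMono`, `badLevels_injOn` — `q ↦ q̂(q)^{Δ'}` is strictly increasing, so distinct excised levels
  have distinct integer labels `n`;
* `card_badLevels_le_floor` — `#badLevels Δ' N ≤ ⌊q̂(2N)^{Δ'}⌋₊`, and the cruder real form
  `card_badLevels_le_rpow` — `#badLevels Δ' N ≤ (2N)^{Δ'/2}` (for `0 < Δ'`);
* `blockPrimes_eq_goodPrimes_union_badLevels`, `disjoint_goodPrimes_badLevels`,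
  `card_blockPrimes_eq` — the primes of the block split as good ⊔ bad, so
  `#goodPrimes Δ' N + #badLevels Δ' N = #{primes in (N, 2N]}`;
* `guard_iff_not_bad` — the heart's guard at a level `q` is literally `q ∉` the excised set (by-name link to
  `KMV2000.qhat`).

CONSEQUENCE FOR [H-struct] (pencil, value-neutral): on the heart's window `Δ' ∈ (1, b)`, `b ≤ 2`, at most
`(2N)^{Δ'/2} = o(N / log N)` levels per dyadic block are excised (and none at all unless `Δ'` lies in the countable
set `{2 log n / log(q / 4π²) : n ≥ 2, q ≥ 41 prime}`), so the level Dirichlet series of §R (R4) is to be typed over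
ALL primes — a genuine prime Dirichlet series, hence `−ζ'/ζ` / `log ζ` explicit-formula germs — with the excision
absorbed into the part `E(w)` analytic on `Re w > x_𝔪 − (1 − Δ'/2) + o(1)` (a signed aggregate is bounded by its
booked absolute mass, `|R⋆_q| ≤ C·𝔪_q` with the ledger's bookkeeping constant, and `𝔪_q` is comparable across the
block: the excised levels carry a share `≤ C·2^{Δ'/2} N^{Δ'/2 − 1} log N · (1 + o(1))` of `𝔪(N)`).  No non-Dirichlet dependence on `q` is injected; the
extraction «negative level average ⇒ one GOOD prime» of (R3) is unaffected (the good-prime average of `r` at the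
selected scales is still `< −(ε₀ − o(1)) N^{Θ'}`).  The tree's `KMV2000.goodPrimesUnbounded_of_lt_two`
(`KMVMomentAsymptoticsUniqueness.lean` :256) is the qualitative shadow of the same injection `q ↦ q̂(q)^{Δ'}`.

Scope / honesty: elementary real analysis and finite combinatorics about the GUARD only.  No bound on U or R⋆,
no Ω-theorem, no zero-free region, no statement about ζ, and no exceptional-zero theorem (no Landau–Siegel /
Siegel-zero exclusion) is proved here; [H-struct] itself stays a NAMED hypothesis.  Typed ≠ proved-about-R⋆.
-/

namespace Summit.Parity.GeneralizedHardyLittlewood.Theorems.PrimeLevelFamEdgeIdeaDeltas.GoodPrimesGuardThin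

open Finset Real
open Literature.NumberTheory.LFunctions

noncomputable section

/-- KMV's scale spelled out without the `NeZero` instance: `q̂(q) = √q / (2π)`
(= `KMV2000.qhat q`, see `qh_eq_qhat`). -/
def qh (q : ℕ) : ℝ := Real.sqrt q / (2 * π)

/-- Bookkeeping lemma `qh_eq_qhat` (LANDING NOTE: docstring added by the typer; statement and proof are the seat's). -/
theorem qh_eq_qhat (q : ℕ) [NeZero q] : qh q = KMV2000.qhat q := rfl

/-- Bookkeeping lemma `qh_nonneg` (LANDING NOTE: docstring added by the typer; statement and proof are the seat's). -/
theorem qh_nonneg (q : ℕ) : 0 ≤ qh q := by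
  unfold qh; positivity

/-- Bookkeeping lemma `qh_pos` (LANDING NOTE: docstring added by the typer; statement and proof are the seat's). -/
theorem qh_pos {q : ℕ} (hq : 0 < q) : 0 < qh q := by
  unfold qh
  have : (0 : ℝ) < q := by exact_mod_cast hq
  positivity

/-- `q ↦ q̂(q)` is strictly increasing on `ℕ`. -/
theorem qh_strictMono : StrictMono qh := by
  intro a b hab
  unfold qh
  have hπ : (0 : ℝ) < 2 * π := by positivity
  have hab' : (a : ℝ) < b := by exact_mod_cast hab
  exact div_lt_div_of_pos_right (Real.sqrt_lt_sqrt (Nat.cast_nonneg _) hab') hπ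

/-- For `0 < Δ'`, `q ↦ q̂(q)^{Δ'}` is strictly increasing on `ℕ`. -/
theorem qh_rpow_strictMono {Δ' : ℝ} (hΔ : 0 < Δ') : StrictMono fun q : ℕ => qh q ^ Δ' := by
  intro a b hab
  exact Real.rpow_lt_rpow (qh_nonneg a) (qh_strictMono hab) hΔ

open Classical in
/-- The primes of the dyadic block `(N, 2N]`. -/
def blockPrimes (N : ℕ) : Finset ℕ :=
  (Icc (N + 1) (2 * N)).filter Nat.Prime

open Classical in
/-- The EXCISED levels of the block: primes `q ∈ (N, 2N]` at which KMV's proviso fails, `q̂(q)^{Δ'} ∈ ℕ`. -/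
def badLevels (Δ' : ℝ) (N : ℕ) : Finset ℕ :=
  (Icc (N + 1) (2 * N)).filter fun q => q.Prime ∧ ∃ n : ℕ, (n : ℝ) = qh q ^ Δ'

/-- Bookkeeping lemma `mem_blockPrimes_iff` (LANDING NOTE: docstring added by the typer; statement and proof are the seat's). -/
theorem mem_blockPrimes_iff {N q : ℕ} : q ∈ blockPrimes N ↔ N + 1 ≤ q ∧ q ≤ 2 * N ∧ q.Prime := by
  classical
  simp only [blockPrimes, mem_filter, mem_Icc, and_assoc]

/-- Bookkeeping lemma `mem_badLevels_iff` (LANDING NOTE: docstring added by the typer; statement and proof are the seat's). -/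
theorem mem_badLevels_iff {Δ' : ℝ} {N q : ℕ} :
    q ∈ badLevels Δ' N ↔ N + 1 ≤ q ∧ q ≤ 2 * N ∧ q.Prime ∧ ∃ n : ℕ, (n : ℝ) = qh q ^ Δ' := by
  classical
  simp only [badLevels, mem_filter, mem_Icc, and_assoc]

/-- The heart's guard at level `q` (`∀ n, n ≠ q̂(q)^{Δ'}`, with the tree's `KMV2000.qhat`) says exactly that
`q` is not an excised level. -/
theorem guard_iff_not_bad {Δ' : ℝ} (q : ℕ) [NeZero q] :
    (∀ n : ℕ, (n : ℝ) ≠ KMV2000.qhat q ^ Δ') ↔ ¬ ∃ n : ℕ, (n : ℝ) = qh q ^ Δ' := by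
  rw [← qh_eq_qhat]; push Not; rfl

/-- The primes of the block split as good ⊔ excised. -/
theorem blockPrimes_eq_goodPrimes_union_badLevels (Δ' : ℝ) (N : ℕ) :
    blockPrimes N = KMV2000.goodPrimes Δ' N ∪ badLevels Δ' N := by
  ext q
  rw [mem_union, mem_blockPrimes_iff, KMV2000.mem_goodPrimes_iff, mem_badLevels_iff]
  constructor
  · rintro ⟨h1, h2, hp⟩
    by_cases h : ∃ n : ℕ, (n : ℝ) = qh q ^ Δ'
    · exact Or.inr ⟨h1, h2, hp, h⟩
    · refine Or.inl ⟨h1, h2, hp, fun n hn => h ⟨n, ?_⟩⟩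
      simpa [qh] using hn
  · rintro (⟨h1, h2, hp, -⟩ | ⟨h1, h2, hp, -⟩) <;> exact ⟨h1, h2, hp⟩

/-- Bookkeeping lemma `disjoint_goodPrimes_badLevels` (LANDING NOTE: docstring added by the typer; statement and proof are the seat's). -/
theorem disjoint_goodPrimes_badLevels (Δ' : ℝ) (N : ℕ) :
    Disjoint (KMV2000.goodPrimes Δ' N) (badLevels Δ' N) := by
  rw [Finset.disjoint_left]
  intro q hg hb
  obtain ⟨-, -, -, hguard⟩ := KMV2000.mem_goodPrimes_iff.mp hg
  obtain ⟨-, -, -, n, hn⟩ := mem_badLevels_iff.mp hb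
  exact hguard n (by simpa [qh] using hn)

/-- `#goodPrimes + #badLevels = #blockPrimes`. -/
theorem card_blockPrimes_eq (Δ' : ℝ) (N : ℕ) :
    (blockPrimes N).card = (KMV2000.goodPrimes Δ' N).card + (badLevels Δ' N).card := by
  rw [blockPrimes_eq_goodPrimes_union_badLevels Δ' N,
    card_union_of_disjoint (disjoint_goodPrimes_badLevels Δ' N)]

/-- The integer label of an excised level, `n(q) = ⌊q̂(q)^{Δ'}⌋₊` (`= q̂(q)^{Δ'}` exactly on `badLevels`). -/
def label (Δ' : ℝ) (q : ℕ) : ℕ := ⌊qh q ^ Δ'⌋₊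

/-- Bookkeeping lemma `label_spec` (LANDING NOTE: docstring added by the typer; statement and proof are the seat's). -/
theorem label_spec {Δ' : ℝ} {N q : ℕ} (hq : q ∈ badLevels Δ' N) : (label Δ' q : ℝ) = qh q ^ Δ' := by
  obtain ⟨-, -, -, n, hn⟩ := mem_badLevels_iff.mp hq
  rw [label, ← hn, Nat.floor_natCast]

/-- Distinct excised levels carry distinct labels (`0 < Δ'`). -/
theorem badLevels_injOn {Δ' : ℝ} (hΔ : 0 < Δ') (N : ℕ) :
    Set.InjOn (label Δ') (badLevels Δ' N : Set ℕ) := by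
  intro a ha b hb hab
  have ha' : (label Δ' a : ℝ) = qh a ^ Δ' := label_spec (mem_coe.mp ha)
  have hb' : (label Δ' b : ℝ) = qh b ^ Δ' := label_spec (mem_coe.mp hb)
  have h : qh a ^ Δ' = qh b ^ Δ' := by rw [← ha', ← hb', hab]
  exact (qh_rpow_strictMono hΔ).injective h

/-- Labels of excised levels lie in `[1, ⌊q̂(2N)^{Δ'}⌋₊]`. -/
theorem label_mem_Icc {Δ' : ℝ} (hΔ : 0 < Δ') {N q : ℕ} (hq : q ∈ badLevels Δ' N) :
    label Δ' q ∈ Icc 1 ⌊qh (2 * N) ^ Δ'⌋₊ := by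
  obtain ⟨h1, h2, -, n, hn⟩ := mem_badLevels_iff.mp hq
  have hlab : (label Δ' q : ℝ) = qh q ^ Δ' := label_spec hq
  rw [mem_Icc]
  constructor
  · have hpos : (0 : ℝ) < qh q ^ Δ' := Real.rpow_pos_of_pos (qh_pos (by omega)) Δ'
    have : (0 : ℝ) < (label Δ' q : ℝ) := by rw [hlab]; exact hpos
    exact_mod_cast this
  · apply Nat.le_floor
    rw [hlab]
    exact (qh_rpow_strictMono hΔ).monotone h2

/-- **Thinness, sharp form.** `#badLevels Δ' N ≤ ⌊q̂(2N)^{Δ'}⌋₊` for `0 < Δ'`. -/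
theorem card_badLevels_le_floor {Δ' : ℝ} (hΔ : 0 < Δ') (N : ℕ) :
    (badLevels Δ' N).card ≤ ⌊qh (2 * N) ^ Δ'⌋₊ := by
  have h := Finset.card_le_card_of_injOn (label Δ') (fun q hq => ?_) (badLevels_injOn hΔ N)
    (s := badLevels Δ' N) (t := Icc 1 ⌊qh (2 * N) ^ Δ'⌋₊)
  · simpa [Nat.card_Icc] using h
  · exact mem_coe.mpr (label_mem_Icc hΔ (mem_coe.mp hq))

/-- Bookkeeping lemma `qh_le_sqrt` (LANDING NOTE: docstring added by the typer; statement and proof are the seat's). -/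
theorem qh_le_sqrt (q : ℕ) : qh q ≤ Real.sqrt q := by
  unfold qh
  have hπ : (1 : ℝ) ≤ 2 * π := by
    have := Real.pi_gt_three; linarith
  exact div_le_self (Real.sqrt_nonneg _) hπ

/-- **Thinness, crude real form.** `#badLevels Δ' N ≤ (2N)^{Δ'/2}` for `0 < Δ'` — against `≍ N/log N`
primes in the block, density `→ 0` on the heart's window `Δ' < 2`. -/
theorem card_badLevels_le_rpow {Δ' : ℝ} (hΔ : 0 < Δ') (N : ℕ) :
    ((badLevels Δ' N).card : ℝ) ≤ (2 * N : ℝ) ^ (Δ' / 2) := by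
  have h1 : ((badLevels Δ' N).card : ℝ) ≤ (⌊qh (2 * N) ^ Δ'⌋₊ : ℝ) := by
    exact_mod_cast card_badLevels_le_floor hΔ N
  have h2 : (⌊qh (2 * N) ^ Δ'⌋₊ : ℝ) ≤ qh (2 * N) ^ Δ' :=
    Nat.floor_le (Real.rpow_nonneg (qh_nonneg _) _)
  have h3 : qh (2 * N) ^ Δ' ≤ Real.sqrt ((2 * N : ℕ) : ℝ) ^ Δ' :=
    Real.rpow_le_rpow (qh_nonneg _) (qh_le_sqrt _) hΔ.le
  have h4 : Real.sqrt ((2 * N : ℕ) : ℝ) ^ Δ' = (2 * N : ℝ) ^ (Δ' / 2) := by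
    rw [Real.rpow_div_two_eq_sqrt Δ' (by positivity)]
    push_cast; rfl
  linarith [h4.le, h4.ge]

/-- **Explicit form of the excised set.** An excised level is `q = (2π)² · n^{2/Δ'}` with `n ≥ 1`
(one transcendental curve in `n`; not a congruence or divisibility class). -/
theorem mem_badLevels_explicit {Δ' : ℝ} (hΔ : 0 < Δ') {N q : ℕ} (hq : q ∈ badLevels Δ' N) :
    ∃ n : ℕ, 1 ≤ n ∧ (q : ℝ) = (2 * π) ^ 2 * (n : ℝ) ^ (2 / Δ') := by
  obtain ⟨h1, -, -, n, hn⟩ := mem_badLevels_iff.mp hq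
  have hqpos : (0 : ℝ) < q := by exact_mod_cast (show 0 < q by omega)
  have hqh : 0 < qh q := qh_pos (by omega)
  have hnpos : (0 : ℝ) < n := by rw [hn]; exact Real.rpow_pos_of_pos hqh Δ'
  refine ⟨n, by exact_mod_cast hnpos, ?_⟩
  -- invert the power: n^{1/Δ'} = q̂(q)
  have hinv : (n : ℝ) ^ Δ'⁻¹ = qh q := by
    rw [hn, Real.rpow_rpow_inv hqh.le hΔ.ne']
  -- square: q̂(q)² = q/(2π)²
  have hsq : qh q ^ (2 : ℕ) = (q : ℝ) / (2 * π) ^ 2 := by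
    unfold qh; rw [div_pow, Real.sq_sqrt hqpos.le]
  have hπ : (0 : ℝ) < (2 * π) ^ 2 := by positivity
  have h2 : (n : ℝ) ^ (2 / Δ') = qh q ^ (2 : ℕ) := by
    rw [div_eq_mul_inv, mul_comm, Real.rpow_mul hnpos.le, hinv, Real.rpow_two]
  rw [h2, hsq]
  field_simp

end

end Summit.Parity.GeneralizedHardyLittlewood.Theorems.PrimeLevelFamEdgeIdeaDeltas.GoodPrimesGuardThin
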